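import Mathlib
import Summits.NavierStokesRegularity.NavierStokesRegularity.Theorems.ThreadingFluxCentreJetLowestTermFacts
import HarnessLib

/-!
# Crux `PoloidalLiouville` (stmt-NavierStokesRegularity-1222, wall W1), crux idea «steady-centre-sieve» (ns-idea-15):
# JET FACTS WITH A FORCING — the lowest Taylor term of the vorticity at an unthreaded centre with zero drift,
# for a FORCED vorticity equation `Δω = curl((V·∇)V) + G`

Support file (`--supports stmt-NavierStokesRegularity-1222`, helper; cell `ns-wall-extremal`, width hand ns-wall-eng-7 g7, 0 kit).
Layer (3b′) of the kernel proof of the «EVOLUTION L1» item of the CentreJet line: the two DYNAMICAL jet facts (J4) `ΔP = 0` and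
(J5) the loop law of ns-wall-eng-7 g6's `ThreadingFluxCentreJetLowestTermFacts` (p695372, steady equation) re-proved for a
vorticity equation with a FORCING TERM `G : ℝ³ → ℝ³` near the centre,

  `Δ(curl V) = curl (x ↦ DV(x)[V(x)]) + G`   near `x₀`

(for a classical Navier–Stokes EVOLUTION at a fixed time, `G = ∂ₜ curl u`).  With `P(y) := Dᵏω(x₀)(y,…,y)`, `ω = curl V`, all
diagonal Taylor terms of `ω` of degree `< k` zero, `V(x₀) = 0`, `div V = 0` near `x₀`:

* (J4′) `laplacian_lowestTerm_forced` — if the diagonal Taylor terms of `G` at `x₀` of degree `< k` vanish (and `G` is smooth at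
  `x₀`), then `ΔP = 0`: the convective right-hand side is still `O(‖y‖ᵏ)` (tree `curl_convect_isBigO`), and `G` is invisible
  at order `k − 2`;
* (J5′) `loopLaw_lowestTerm_forced` — if `⟪x − x₀, G x⟫ = 0` near `x₀` (and `⟪x − x₀, ω⟫ = 0` near `x₀`), then
  `⟪y, DP(y)[Sy] − S P(y)⟫ = 0`, `S = DV(x₀)`: the raw loop law `⟪x − x₀, Δω⟫ = 0` is kinematic, so
  `⟪x − x₀, (V·∇)ω − (ω·∇)V⟫ = ⟪x − x₀, Δω − G⟫ = 0` near `x₀`, and the lowest-order argument of (J5) goes through verbatim.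

The steady lemmas (G = 0) are untouched (import-never-restate: the kinematic facts (J2)/(J3), `curl_convect_isBigO`,
`inner_laplacian_curl_eventually` and ns-wall-eng-5's `AnalyticOrder` are used BY NAME).
HONEST FRAME: helper lemmas about one crux idea's objects; closes no crux or sketch Prop; `PoloidalLiouville` (1222) and NS
regularity OPEN.
-/

-- the summit and its single sub-problem share the name (CONVENTIONS §1)
set_option linter.dupNamespace false

noncomputable section

namespace Summit.NavierStokesRegularity.NavierStokesRegularity.Theorems.PoloidalLiouville.CentreJet.LowestTerm

open Set Function Filter Topology Asymptotics InnerProductSpace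
open scoped ContDiff Nat RealInnerProductSpace
open Literature.Analysis.FluidPDE

variable {V : E3 → E3} {G : E3 → E3} {x₀ : E3}

/-! ### (J4′) the lowest term is harmonic, forced vorticity equation -/

/-- **(J4′) The lowest term is HARMONIC, forced form**: if `Δω = curl((V·∇)V) + G` near `x₀` with `G` smooth at `x₀` and all
diagonal Taylor terms of `G` at `x₀` of degree `< k` zero, then `Δ (y ↦ Dᵏω(x₀)(y,…,y)) = 0` — the vorticity equation read at
order `k − 2`: `curl((V·∇)V)` is `O(‖y‖ᵏ)` at a centre with zero drift, and `G` does not contribute below order `k`. -/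
theorem laplacian_lowestTerm_forced (hV : ContDiff ℝ 2 V) (hVω : ContDiffAt ℝ ω V x₀)
    (hvort : Laplacian.laplacian (curl V) =ᶠ[𝓝 x₀] fun x => curl (fun z => fderiv ℝ V z (V z)) x + G x)
    (hG : ContDiffAt ℝ ∞ G x₀) (hdiv : ∀ᶠ x in 𝓝 x₀, VectorCalculus.divergence V x = 0) (h0 : V x₀ = 0) {k : ℕ}
    (hGlow : ∀ n < k, ∀ y : E3, iteratedFDeriv ℝ n G x₀ (fun _ => y) = 0)
    (hlow : ∀ n < k, ∀ y : E3, iteratedFDeriv ℝ n (curl V) x₀ (fun _ => y) = 0) (y : E3) :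
    Laplacian.laplacian (fun y : E3 => iteratedFDeriv ℝ k (curl V) x₀ (fun _ => y)) y = 0 := by
  have hω := contDiffAt_curl_omega hVω
  rcases k with _ | _ | m
  · -- `k = 0`: constant
    have : (fun y : E3 => iteratedFDeriv ℝ 0 (curl V) x₀ (fun _ => y)) = fun _ => curl V x₀ := by
      funext z; simp
    rw [this, laplacian_const]
    rfl
  · -- `k = 1`: linear
    have hlin : (fun y : E3 => iteratedFDeriv ℝ 1 (curl V) x₀ (fun _ => y)) = fun y => fderiv ℝ (curl V) x₀ y := by
      funext z; simp
    rw [hlin, congrFun (laplacian_eq_iteratedFDeriv_orthonormalBasis (fun y => fderiv ℝ (curl V) x₀ y)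
      (EuclideanSpace.basisFun (Fin 3) ℝ)) y]
    refine Finset.sum_eq_zero fun i _ => ?_
    rw [iteratedFDeriv_two_apply]
    have hD : fderiv ℝ (fun y => fderiv ℝ (curl V) x₀ y) = fun _ => fderiv ℝ (curl V) x₀ := by
      funext z; exact (fderiv ℝ (curl V) x₀).fderiv
    rw [hD]
    simp
  · -- `k = m + 2`: the forced vorticity equation at order `m`
    rw [JetCalculus.laplacian_diag hω m y]
    suffices h : iteratedFDeriv ℝ m (Laplacian.laplacian (curl V)) x₀ (fun _ => y) = 0 by
      rw [h, smul_zero]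
    rw [JetCalculus.diag_congr hvort m y]
    have hN := curl_convect_isBigO hV hVω hdiv h0 (m := m + 1) hlow
    have hc : ContDiffAt ℝ m (fun x => curl (fun z => fderiv ℝ V z (V z)) x) x₀ :=
      (contDiffAt_curl_convect_omega hVω).of_le le_top
    have hGm : ContDiffAt ℝ m G x₀ := hG.of_le (by exact_mod_cast le_top)
    rw [fun_iteratedFDeriv_add_apply hc hGm, add_apply,
      AnalyticOrder.diag_eq_zero_of_isBigO (contDiffAt_curl_convect_omega hVω).analyticAt hN m (by omega) y,
      hGlow m (by omega) y, add_zero]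

/-! ### (J5′) the loop law at lowest order, forced vorticity equation -/

/-- **(J5′) The LOOP LAW at lowest order, forced form**: `⟪y, DP(y)[Sy] − S P(y)⟫ = 0` with `P(y) = Dᵏω(x₀)(y,…,y)` and
`S = DV(x₀)`, when `Δω = curl((V·∇)V) + G` near `x₀` with a forcing TANGENT to the spheres about `x₀`, `⟪x − x₀, G x⟫ = 0`
near `x₀` — the `(k+1)`-st Taylor term of `⟪x − x₀, (V·∇)ω − (ω·∇)V⟫ = ⟪x − x₀, Δω − G⟫ = 0`. -/
theorem loopLaw_lowestTerm_forced (hV : ContDiff ℝ 3 V) (hVω : ContDiffAt ℝ ω V x₀)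
    (hvort : Laplacian.laplacian (curl V) =ᶠ[𝓝 x₀] fun x => curl (fun z => fderiv ℝ V z (V z)) x + G x)
    (hGtan : ∀ᶠ x in 𝓝 x₀, ⟪x - x₀, G x⟫ = 0)
    (hdiv : ∀ᶠ x in 𝓝 x₀, VectorCalculus.divergence V x = 0) (htan : ∀ᶠ x in 𝓝 x₀, ⟪x - x₀, curl V x⟫ = 0)
    (h0 : V x₀ = 0) {k : ℕ} (hlow : ∀ n < k, ∀ y : E3, iteratedFDeriv ℝ n (curl V) x₀ (fun _ => y) = 0) (y : E3) :
    ⟪y, fderiv ℝ (fun y : E3 => iteratedFDeriv ℝ k (curl V) x₀ (fun _ => y)) y (fderiv ℝ V x₀ y) -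
      fderiv ℝ V x₀ (iteratedFDeriv ℝ k (curl V) x₀ (fun _ => y))⟫ = 0 := by
  have hω := contDiffAt_curl_omega hVω
  have hV2 : ContDiff ℝ 2 V := hV.of_le (by norm_num)
  set S := fderiv ℝ V x₀ with hS
  rcases k with _ | m
  · -- `k = 0`: the constant term vanishes by tangency
    have hz : curl V x₀ = 0 := by
      have h := tangent_lowestTerm hVω htan (k := 0) (fun n hn => absurd hn (Nat.not_lt_zero n)) (curl V x₀)
      simpa using h
    have : (fun y : E3 => iteratedFDeriv ℝ 0 (curl V) x₀ (fun _ => y)) = fun _ => 0 := by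
      funext z; simp [hz]
    rw [this]
    simp [hz]
  · -- `k = m + 1`
    set c : ℝ := ((m + 1) ! : ℝ) with hc
    have hc0 : c ≠ 0 := by rw [hc]; exact_mod_cast Nat.factorial_ne_zero (m + 1)
    set Pn : E3 → E3 := fun y => c⁻¹ • iteratedFDeriv ℝ (m + 1) (curl V) x₀ (fun _ => y) with hPn
    have hPnd : ∀ z, DifferentiableAt ℝ Pn z := fun z => by
      have h : HasFDerivAt Pn
          (c⁻¹ • fderiv ℝ (fun y : E3 => iteratedFDeriv ℝ (m + 1) (curl V) x₀ (fun _ => y)) z) z :=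
        (JetCalculus.differentiable_diag (f := curl V) (x₀ := x₀) (m + 1) z).hasFDerivAt.const_smul c⁻¹
      exact h.differentiableAt
    -- the normalised loop term and its pairing with `y`
    set g : E3 → ℝ := fun y => ⟪y, fderiv ℝ Pn y (S y) - S (Pn y)⟫ with hg
    -- homogeneity of degree `m + 2`
    have hfd : ∀ (a : ℝ) (z e : E3), fderiv ℝ Pn (a • z) e = a ^ m • fderiv ℝ Pn z e := fun a z e => by
      simp only [hPn]
      rw [fderiv_fun_const_smul (JetCalculus.differentiable_diag (m + 1) (a • z)),
        fderiv_fun_const_smul (JetCalculus.differentiable_diag (m + 1) z), smul_apply, smul_apply,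
        JetCalculus.fderiv_diag_succ_smul hω m a z e, smul_comm]
    have hhom : ∀ (a : ℝ) (z : E3), g (a • z) = a ^ (m + 2) • g z := fun a z => by
      have hP : Pn (a • z) = a ^ (m + 1) • Pn z := by
        simp only [hPn, JetCalculus.diag_smul]; rw [smul_comm]
      simp only [hg]
      rw [map_smul, map_smul, hfd, hP, map_smul, smul_smul, show a * a ^ m = a ^ (m + 1) by ring, ← smul_sub,
        real_inner_smul_left, real_inner_smul_right, smul_eq_mul]
      ring
    -- `g = O(‖y‖^(m+3))`
    have hO : g =O[𝓝 0] fun z : E3 => ‖z‖ ^ (m + 2 + 1) := by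
      -- the convective bracket minus the loop term is small
      have h1 := convect_sub_lowest_isBigO hVω hω h0 hlow
      have h1' := inner_isBigO h1.neg_left
      -- `⟪y, (V·∇)ω − (ω·∇)V⟫ = 0` near `0`: forced vorticity equation + raw loop law + tangential forcing + `div V = 0`
      have h2 : (fun y : E3 => ⟪y, fderiv ℝ (curl V) (x₀ + y) (V (x₀ + y)) - fderiv ℝ V (x₀ + y) (curl V (x₀ + y))⟫)
          =O[𝓝 0] fun z : E3 => ‖z‖ ^ (m + 2 + 1) := by
        refine (isBigO_zero _ _).congr' ?_ EventuallyEq.rfl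
        filter_upwards [eventually_nhds_zero_of_eventually hdiv,
          eventually_nhds_zero_of_eventually (inner_laplacian_curl_eventually hV htan),
          eventually_nhds_zero_of_eventually hvort, eventually_nhds_zero_of_eventually hGtan] with y hy hL hE hGy
        have hc' := curl_convect_self hV2 (x₀ + y)
        simp only [convect_apply] at hc'
        have hcv : (convect V V) = fun x => fderiv ℝ V x (V x) := rfl
        rw [hcv, hy, zero_smul, add_zero] at hc'
        have hE' : curl (fun z => fderiv ℝ V z (V z)) (x₀ + y) = Laplacian.laplacian (curl V) (x₀ + y) - G (x₀ + y) := by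
          rw [hE]; abel
        have hL' : ⟪y, Laplacian.laplacian (curl V) (x₀ + y)⟫ = 0 := by simpa using hL
        have hG' : ⟪y, G (x₀ + y)⟫ = 0 := by simpa using hGy
        rw [← hc', hE', inner_sub_right, hL', hG', sub_zero]
      refine (h2.add h1').congr (fun z => ?_) (fun _ => rfl)
      simp only [hg, hPn, hS, hc]
      rw [← inner_add_right]
      congr 1
      abel
    have hg0 := AnalyticOrder.eq_zero_of_homogeneous_of_isBigO hhom hO y
    -- unnormalise
    have e2 : iteratedFDeriv ℝ (m + 1) (curl V) x₀ (fun _ => y) = c • Pn y := by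
      simp only [hPn, smul_smul, mul_inv_cancel₀ hc0, one_smul]
    have hPPn : (fun y : E3 => iteratedFDeriv ℝ (m + 1) (curl V) x₀ (fun _ => y)) = fun y => c • Pn y := by
      funext z
      simp only [hPn, smul_smul, mul_inv_cancel₀ hc0, one_smul]
    have e1 : fderiv ℝ (fun y : E3 => iteratedFDeriv ℝ (m + 1) (curl V) x₀ (fun _ => y)) y (S y) =
        c • fderiv ℝ Pn y (S y) := by
      rw [hPPn, fderiv_fun_const_smul (hPnd y), smul_apply]
    rw [e1, e2, map_smul, ← smul_sub, real_inner_smul_right]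
    simp only [hg] at hg0
    rw [hg0, mul_zero]

end Summit.NavierStokesRegularity.NavierStokesRegularity.Theorems.PoloidalLiouville.CentreJet.LowestTerm

end
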